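import Literature.Combinatorics.Digraph.IteratedLineDigraph
import HarnessLib

/-!
# Levine's Fibonacci example: `κ(Lⁿ G) = 2^{F_{n+2}}` for `G = ({0, 1}, {00, 01, 10})`

Topic `Literature/Combinatorics/Digraph`, namespace `Literature.Combinatorics.Digraph.Multidigraph`.
Lane `lit-hodgefound`, seat p23, generation 46, row g46-#17 of the programme «The spectrum of the arc
digraph and de Bruijn's count `2^{2^{n−1}−n}`» (the non-regular example of `IteratedLineDigraph`,
Levine's Theorem 4.1).

## Source, verbatim

L. Levine, *Sandpile groups and spanning trees of directed line graphs*, J. Combin. Theory Ser. A 118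
(2011) 350–364 [Levine2011], §4 (held text `paper:arxiv-0906.2809`, chunk p0010):
«Perhaps less familiar is the situation when `G` is not regular. As an example, consider the graph
`G = ({0, 1}, {(0,0), (0,1), (1,0)})`. The vertices of its iterated line graph `Lⁿ G` are binary words of
length `n + 1` containing no two consecutive `1`'s. The number of such words is the Fibonacci number
`F_{n+3}`, and the number of words ending in `0` is `F_{n+2}`. By Theorem 4.1, the number of oriented
spanning trees of `Lⁿ G` is `κ(Lⁿ G) = 2 · 2^{p(n,0) − 1} = 2^{F_{n+2}}`.»

## What is here (a definition with body, theorems; no named fact, no instance, no notation)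

* §1 (every multidigraph) **`numPaths_succ_eq_sum_inArcs`** — the forward recursion
  `p(k+2, v) = Σ_{a : u → v} p(k+1, u)` (split a path at its last edge);
  `card_paths_eq_sum_numPaths` (`|E_{k+1}| = Σ_v p(k+1, v)`).
* §2 `goldenMeanDigraph : Multidigraph (Fin 2) (Fin 3)` — Levine's `G` (arcs `00, 01, 10`), its degrees,
  **`numPaths_goldenMeanDigraph_zero/one`** (`p(k+1, 0) = F_{k+3}`, `p(k+1, 1) = F_{k+2}` with Mathlib's
  `Nat.fib`, `F_1 = F_2 = 1`), `card_paths_goldenMeanDigraph` («the number of such words is `F_{n+3}`»),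
  `card_arborescencesTo_goldenMeanDigraph` (`κ(G, 0) = κ(G, 1) = 1`) and
  **`sum_card_arborescencesTo_pathDigraph_goldenMeanDigraph`** — «`κ(Lⁿ G) = 2^{F_{n+2}}`» (`n = k + 1`).

## References

* [Levine2011] L. Levine, *Sandpile groups and spanning trees of directed line graphs*, J. Combin.
  Theory Ser. A 118 (2011) 350–364, §4 (the example after Theorem 4.1).
* Tree: `Digraph/IteratedLineDigraph` (`pathDigraph`, `numPaths`, `sum_card_arborescencesTo_pathDigraph`),
  `Digraph/MultidigraphAdjacencyMatrix` (`card_arborescencesTo_eq_det_laplacian`, `laplacian_apply_self`).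
-/

namespace Literature.Combinatorics.Digraph

namespace Multidigraph

open Finset

variable {V A : Type*} (G : Multidigraph V A)

/-! ### §1 Splitting a path at its last edge -/

section LastEdge

variable [Fintype A] [DecidableEq V] [DecidableEq A]

/-- **`p(k+2, v) = Σ_{a : u → v} p(k+1, u)`**: a path of `k + 2` edges ending at `v` is a path of `k + 1`
edges followed by an edge `a` into `v`. [cite: Levine2011, §4 («the number of words ending in `0` is
`F_{n+2}`»: the Fibonacci recursion)] -/
theorem numPaths_succ_eq_sum_inArcs (k : ℕ) (v : V) :
    G.numPaths (k + 1) v = ∑ a ∈ G.inArcs v, G.numPaths k (G.src a) := by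
  rw [numPaths, Finset.card_eq_sum_card_fiberwise
    (f := fun q : {q : Fin (k + 2) → A // G.IsPath q} => q.1 (Fin.last (k + 1))) (t := G.inArcs v)
    (fun q hq => by simpa using hq)]
  refine Finset.sum_congr rfl fun a ha => ?_
  rw [mem_inArcs] at ha
  rw [numPaths]
  refine Finset.card_bij (fun q _ => ⟨Fin.init q.1, q.2.init⟩) (fun q hq => ?_)
    (fun q₁ hq₁ q₂ hq₂ h => ?_) (fun p hp => ?_)
  · rw [Finset.mem_filter] at hq
    rw [Finset.mem_filter]
    refine ⟨mem_univ _, ?_⟩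
    have h2 := q.2 (Fin.last k)
    rw [Fin.succ_last, hq.2] at h2
    exact h2.symm
  · apply Subtype.ext
    rw [Finset.mem_filter] at hq₁ hq₂
    rw [← Fin.snoc_init_self q₁.1, ← Fin.snoc_init_self q₂.1]
    have h1 : Fin.init q₁.1 = Fin.init q₂.1 := congrArg Subtype.val h
    have h3 : q₁.1 (Fin.last (k + 1)) = q₂.1 (Fin.last (k + 1)) := by rw [hq₁.2, hq₂.2]
    rw [h1, h3]
  · rw [Finset.mem_filter] at hp
    refine ⟨⟨Fin.snoc p.1 a, p.2.snoc hp.2.symm⟩, ?_, ?_⟩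
    · refine Finset.mem_filter.2 ⟨Finset.mem_filter.2 ⟨mem_univ _, ?_⟩, ?_⟩
      · show G.tgt (Fin.snoc (α := fun _ => A) p.1 a (Fin.last (k + 1))) = v
        rw [Fin.snoc_last, ha]
      · show Fin.snoc (α := fun _ => A) p.1 a (Fin.last (k + 1)) = a
        exact Fin.snoc_last _ _
    · exact Subtype.ext (by
        show Fin.init (Fin.snoc (α := fun _ => A) p.1 a) = p.1
        exact Fin.init_snoc _ _)

omit [DecidableEq A] in
/-- `|E_{k+1}| = Σ_v p(k+1, v)` (paths sorted by their last vertex). [cite: Levine2011, §4 («The number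
of such words is the Fibonacci number `F_{n+3}`»)] -/
theorem card_paths_eq_sum_numPaths [Fintype V] (k : ℕ) :
    Fintype.card {p : Fin (k + 1) → A // G.IsPath p} = ∑ v, G.numPaths k v := by
  rw [← Finset.card_univ, Finset.card_eq_sum_card_fiberwise
    (f := fun p : {p : Fin (k + 1) → A // G.IsPath p} => G.tgt (p.1 (Fin.last k))) (t := univ)
    (fun _ _ => Finset.mem_coe.2 (mem_univ _))]
  rfl

end LastEdge

/-! ### §2 `G = ({0, 1}, {00, 01, 10})` -/

section GoldenMean

/-- **Levine's digraph `G = ({0, 1}, {(0,0), (0,1), (1,0)})`**: the arcs `0 = 00`, `1 = 01`, `2 = 10`; the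
vertices of `Lⁿ G` are the binary words of length `n + 1` with no two consecutive `1`'s.
[cite: Levine2011, §4] -/
def goldenMeanDigraph : Multidigraph (Fin 2) (Fin 3) := ⟨![0, 0, 1], ![0, 1, 0]⟩

/-- [cite: Levine2011, §4] -/
theorem inArcs_goldenMeanDigraph_zero : goldenMeanDigraph.inArcs 0 = {0, 2} := by decide

/-- [cite: Levine2011, §4] -/
theorem inArcs_goldenMeanDigraph_one : goldenMeanDigraph.inArcs 1 = {1} := by decide

/-- [cite: Levine2011, §4] -/
theorem inDeg_goldenMeanDigraph_zero : goldenMeanDigraph.inDeg 0 = 2 := by decide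

/-- [cite: Levine2011, §4] -/
theorem inDeg_goldenMeanDigraph_one : goldenMeanDigraph.inDeg 1 = 1 := by decide

/-- [cite: Levine2011, §4] -/
theorem outDeg_goldenMeanDigraph_zero : goldenMeanDigraph.outDeg 0 = 2 := by decide

/-- [cite: Levine2011, §4] -/
theorem outDeg_goldenMeanDigraph_one : goldenMeanDigraph.outDeg 1 = 1 := by decide

/-- [cite: Levine2011, §4] -/
theorem arcCount_goldenMeanDigraph_zero_zero : goldenMeanDigraph.arcCount 0 0 = 1 := by decide

/-- [cite: Levine2011, §4] -/
theorem arcCount_goldenMeanDigraph_one_one : goldenMeanDigraph.arcCount 1 1 = 0 := by decide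

/-- **`p(k+1, 0) = F_{k+3}` and `p(k+1, 1) = F_{k+2}`** (paths of `k + 1` edges ending at `0`, resp. `1`,
i.e. binary words of length `k + 2` with no two consecutive `1`'s ending in `0`, resp. `1`).
[cite: Levine2011, §4 («the number of words ending in `0` is `F_{n+2}`»)] -/
theorem numPaths_goldenMeanDigraph (k : ℕ) :
    goldenMeanDigraph.numPaths k 0 = Nat.fib (k + 3) ∧ goldenMeanDigraph.numPaths k 1 = Nat.fib (k + 2) := by
  induction k with
  | zero =>
    rw [numPaths_zero, numPaths_zero, inDeg_goldenMeanDigraph_zero, inDeg_goldenMeanDigraph_one]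
    decide
  | succ k ih =>
    rw [numPaths_succ_eq_sum_inArcs, numPaths_succ_eq_sum_inArcs, inArcs_goldenMeanDigraph_zero,
      inArcs_goldenMeanDigraph_one, Finset.sum_pair (by decide), Finset.sum_singleton]
    refine ⟨?_, ?_⟩
    · show goldenMeanDigraph.numPaths k 0 + goldenMeanDigraph.numPaths k 1 = Nat.fib (k + 4)
      rw [ih.1, ih.2]
      simp only [Nat.fib_add_two]
      ring
    · show goldenMeanDigraph.numPaths k 0 = Nat.fib (k + 3)
      exact ih.1

/-- [cite: Levine2011, §4] -/
theorem numPaths_goldenMeanDigraph_zero (k : ℕ) : goldenMeanDigraph.numPaths k 0 = Nat.fib (k + 3) :=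
  (numPaths_goldenMeanDigraph k).1

/-- [cite: Levine2011, §4] -/
theorem numPaths_goldenMeanDigraph_one (k : ℕ) : goldenMeanDigraph.numPaths k 1 = Nat.fib (k + 2) :=
  (numPaths_goldenMeanDigraph k).2

/-- **«The number of such words is the Fibonacci number `F_{n+3}`»**: `Lⁿ G` has `F_{n+3}` vertices
(`n = k + 1`). [cite: Levine2011, §4] -/
theorem card_paths_goldenMeanDigraph (k : ℕ) :
    Fintype.card {p : Fin (k + 1) → Fin 3 // goldenMeanDigraph.IsPath p} = Nat.fib (k + 4) := by
  rw [card_paths_eq_sum_numPaths, Fin.sum_univ_two, numPaths_goldenMeanDigraph_zero,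
    numPaths_goldenMeanDigraph_one]
  simp only [Nat.fib_add_two]
  ring

/-- `κ(G, 0) = κ(G, 1) = 1` (the trees `1 → 0` and `0 → 1`). [cite: Levine2011, §4 («`κ(Lⁿ G) = 2 · …`»:
`κ(G) = 2`)] -/
theorem card_arborescencesTo_goldenMeanDigraph (s : Fin 2) : (goldenMeanDigraph.arborescencesTo s).card = 1 := by
  -- the other vertex
  obtain ⟨t, hts, huniq⟩ : ∃ t : Fin 2, t ≠ s ∧ ∀ v : Fin 2, v ≠ s → v = t := by
    refine ⟨1 - s, by omega, fun v hv => by omega⟩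
  haveI : Unique {v : Fin 2 // v ≠ s} :=
    { default := ⟨t, hts⟩
      uniq := fun v => Subtype.ext (huniq v.1 v.2) }
  have h := goldenMeanDigraph.card_arborescencesTo_eq_det_laplacian (R := ℤ) s
  rw [Matrix.det_unique, show (default : {v : Fin 2 // v ≠ s}) = ⟨t, hts⟩ from Subsingleton.elim _ _,
    Matrix.submatrix_apply, laplacian_apply_self] at h
  have ht : ∀ u : Fin 2, (goldenMeanDigraph.outDeg u : ℤ) - goldenMeanDigraph.arcCount u u = 1 := by
    decide
  rw [ht t] at h
  exact_mod_cast h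

/-- **«By Theorem 4.1, the number of oriented spanning trees of `Lⁿ G` is
`κ(Lⁿ G) = 2 · 2^{p(n,0) − 1} = 2^{F_{n+2}}`»** (`n = k + 1`; `κ(G) = 2`, `outdeg(0) = 2`, `outdeg(1) = 1`,
`p(k+1, 0) = F_{k+3}`). [cite: Levine2011, §4] -/
theorem sum_card_arborescencesTo_pathDigraph_goldenMeanDigraph (k : ℕ) :
    ∑ p, ((goldenMeanDigraph.pathDigraph k).arborescencesTo p).card = 2 ^ Nat.fib (k + 3) := by
  rw [goldenMeanDigraph.sum_card_arborescencesTo_pathDigraph (fun v => by fin_cases v <;> decide) k,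
    Fin.sum_univ_two, Fin.prod_univ_two, card_arborescencesTo_goldenMeanDigraph,
    card_arborescencesTo_goldenMeanDigraph, numPaths_goldenMeanDigraph_zero, numPaths_goldenMeanDigraph_one,
    outDeg_goldenMeanDigraph_zero, outDeg_goldenMeanDigraph_one, one_pow, mul_one]
  have hf : 1 ≤ Nat.fib (k + 3) := Nat.fib_pos.2 (by omega)
  rw [show (1 + 1) * 2 ^ (Nat.fib (k + 3) - 1) = 2 ^ (Nat.fib (k + 3) - 1 + 1) by ring,
    Nat.sub_add_cancel hf]

end GoldenMean

end Multidigraph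

end Literature.Combinatorics.Digraph
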